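import Literature.NumberTheory.EllipticCurves.TakahashiDegreeFormulaSetupProofs
import HarnessLib

/-!
# Takahashi 2001, Thm. 2.3 at a prime `r ∥ N`: reductions and corollaries of
# `takahashi2001_thm_2_3_of_coprime`

Topic `Literature/NumberTheory/EllipticCurves`; theorems only (no definition, no named fact).
Sibling of `TakahashiDegreeFormula.lean` (the NAMED FACTS `takahashi2001_thm_2_3` — Takahashi's
standing hypothesis "`N = M r` square-free" — and `takahashi2001_thm_2_3_of_coprime` — the same at
a prime `r` with `gcd(M, r) = 1`, i.e. `r ∥ N`, `M` arbitrary), of `TakahashiDegreeFormulaProofs.lean`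
(the algebra of §2: `Takahashi2001.exists_nat_index_formula`, `Takahashi2001.exists_ij_of_brandtData`)
and of `TakahashiDegreeFormulaSetupProofs.lean` (independence of the Brandt setup for the
square-free fact).

Source: S. Takahashi, *Degrees of parametrizations of elliptic curves by Shimura curves*,
J. Number Theory **90** (2001) 74–88 [Takahashi2001], read in full (`lit read
doi:10.1006/jnth.2000.2614`, pp. 74–85): **Theorem 2.3** (p. 79) *"`i_r` divides `h_r`, and
`δ = (h_r/i_r) · j_r`. In particular, `j_r` divides `δ`"*, its proof (p. 80:
`δ · c_r = j_r² · h_r`, `j_r = c_r / i_r`), and the remark (p. 80) *"The results stated so far are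
true for any prime `r` dividing `N`"*; §3.2, proof of Thm. 3.8 (p. 84): `X_r(J)` is the degree-zero
part of the Brandt module of the Eichler order of level `m`, Hecke- and pairing-compatibly
(Buzzard Thm. 4.7; for `D = 1` Ribet 1990 §3).

## What is proved here

Everything the tree can say about the prime-exactly-dividing fact short of the geometric
dictionary itself, mirroring for `takahashi2001_thm_2_3_of_coprime` what the two sibling proof
files record for `takahashi2001_thm_2_3`:

* `takahashi2001_thm_2_3_of_coprime.nonempty_xiSetup` — **Brandt setups of type `(M, r)` exist**
  for `r` prime, `M ≥ 1`, `gcd(M, r) = 1` (the tree's theorem `nonempty_eichlerPackage_holds`;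
  no square-freeness of `M` is involved: Eichler orders of every level `M` prime to the
  discriminant exist).
* `takahashi2001_thm_2_3_of_coprime_of_exists_setup` — **the fact follows from its conclusion in
  ONE setup per optimal curve** (`Brandt.XiSetup.xi_eq_xi`: all setups of type `(M, r)` have the
  same `ξ`; proved in the tree for every level, Vignéras III §5).
* `takahashi2001_thm_2_3_of_coprime_of_brandtDictionary_one` (explicit generator) and
  `takahashi2001_thm_2_3_of_coprime_of_brandtDictionary_one'` (rank form) — **the fact from the
  character-group dictionary of §2 in one Brandt setup**: the hypothesis is literally the
  hypothesis `H` of `takahashi2001_thm_2_3_of_brandtDictionary_one` with `Squarefree (M * r)`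
  replaced by `M.Coprime r` and minimality restricted to curves of conductor `M r` — i.e. the
  data (M1) Néron models / character groups / Grothendieck's pairing with adjointness of `π^*`,
  `π_*` [SGA7 IX 11.5 = Takahashi Prop. 1.1], (M2) the optimal quotient with
  `π_* π^* = δ = P.modularDegree` and `π_*` onto, (M4) Ribet's isometry
  `X_r(J₀(Mr)) ≅ ℤ[Cls O]⁰` at `r ∤ M` (`M ≥ 1` arbitrary), (M5) multiplicity one — for the one
  supersingular Eichler order. The pointwise engine `Takahashi2001.exists_ij_of_brandtData` never
  used square-freeness, so the printed proof goes through verbatim at `r ∥ N`, as Takahashi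
  remarks (p. 80).
* Corollaries PROVED from the named fact (namespace `takahashi2001_thm_2_3_of_coprime`), the
  `r ∥ N` counterparts of those in `TakahashiDegreeFormula.lean`:
  `xi_mul_eq_modularDegree_mul_sq` (**`ξ_S · c_r = δ · i_r²`**, the displayed identity
  `δ c_r = j_r² h_r` of the proof of Thm. 2.3 rewritten with `c_r = i_r j_r`),
  `modularDegree_dvd_xi_mul` (`δ ∣ ξ_S · c_r`), `exists_coker_dvd_modularDegree` (**"in particular
  `j_r` divides `δ`"**), `modularDegree_le_xi_mul` / `modularDegree_le_brandtXi_mul`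
  (`δ ≤ ξ · ord_r Δ_min`, no existence hypothesis: setups exist), `xi_pos` / `brandtXi_pos`
  (the `a(E)`-eigen-lattice is an honest line, `ξ ≥ 1`).

What is NOT here: the dictionary (M1), (M2), (M4), (M5) — Néron models of `J₀(N)`, Grothendieck's
monodromy pairing, Deligne–Rapoport / Ribet 1990 §3, Jacquet–Langlands with strong multiplicity
one, and the comparison of the analytic degree `ModularParametrizationData.deg_spec` with
`π ∘ π^∨` — none of which is in Mathlib or the tree (searched `monodromy|componentGroup|
characterGroup|NeronModel|J0|Jacobian`); hence `takahashi2001_thm_2_3_of_coprime_holds` is not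
proved.

## Numerical audit of the rendering (2026-08-16, PARI/GP 2.15.4, all X₀(N)-optimal curves found)

Because the extension from "`N` square-free" to "`r ∥ N`" is not printed as such, the exact
statement of `takahashi2001_thm_2_3_of_coprime` was checked numerically, in the tree's
normalisations: for every `X₀(N)`-optimal curve `E` located in 363 isogeny classes of conductor
`N ≤ 300` (Cremona's list plus a box search; optimality by `ellweilcurve`) and every prime
`r ∥ N` (578 pairs `(E, r)`, 188 level types `(M, r)`, 76 of them with `M` NOT square-free:
`M ∈ {4, 8, 9, 16, 25, 27, 32, 36, 49, 64, 81, 100, 121, …, 147}`), with `O` an Eichler order of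
level `M` (an intersection of two maximal orders of index `M`, as in `Brandt.IsEichlerOrder`) in the
quaternion algebra ramified at `{r, ∞}`, `Cls O` by `p`-neighbours (Eichler's mass formula
`Σ 1/w_c = (r−1)/12 · M ∏_{p∣M}(1+1/p)` confirmed each time, `w_c = #O_L(I_c)ˣ/2` as in
`Brandt.weight`, class numbers up to `46`), Brandt matrices `T(p)_{ij} = #{J ⊆ I_j : [I_j:J] = p²,
J ~ I_i}` at primes `p ∤ N` acting by `mulVec` (as in `Brandt.eigenLattice`), `g` the primitive
generator of the common kernel of the `T(p) − a_p(E)` (always of rank one after 2–4 primes, always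
of degree zero), `ξ = Σ_c w_c g_c²`, `c_r = ord_r Δ_min(E)`, `δ = ellmoddegree(E)`: in all 578
cases there are `i, j` with `0 < i`, `i j = c_r`, `i ∣ ξ`, `δ i = ξ j`, and moreover the finer
prediction of the character-group dictionary holds — `i = i_r :=` the positive generator of
`{Σ_c w_c g_c y_c : Σ_c y_c = 0}` (`= gcd_{a<b}(w_a g_a − w_b g_b)`), `j = c_r / i_r`,
`δ c_r = j² ξ` — while it fails for most non-optimal members of the same classes (so optimality is
essential). No counterexample, no anomaly. (Seat folder `evidence/SUMMARY.md`, logs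
`takahashi_check_N11-300_box_j018422.log`; script `compute/takahashi_check.gp`.)

## References

* [Takahashi2001] S. Takahashi, J. Number Theory 90 (2001) 74–88, doi:10.1006/jnth.2000.2614 —
  §2 Lemma 2.2, Thm. 2.3 (p. 79), remark p. 80, §3.2 proof of Thm. 3.8 (p. 84). READ.
* [Ribet1990] K. Ribet, Invent. Math. 100 (1990), §3 (Prop. 3.1–3.3).
* [PastenShimura2024] H. Pasten, Shimura curves and the abc conjecture, J. Number Theory 254
  (2024) = arXiv:1705.09251, Prop. 6.13 (the Ribet–Takahashi computation needs only
  multiplicative reduction at the prime, not `M` square-free).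
* [VignerasLNM800] M.-F. Vignéras, LNM 800 (1980), Ch. III §3 Thm. 3.1, §5.
-/

namespace Literature.NumberTheory.EllipticCurves

open Literature.NumberTheory.Automorphic Literature.NumberTheory.EllipticCurves.ModularForms

/-! ### Brandt setups of type `(M, r)` exist for `r` prime, `M ≥ 1`, `gcd(M, r) = 1` -/

/-- **Brandt setups of type `(M, r)` exist** for `r` prime, `0 < M` and `gcd(M, r) = 1`: `r` is
square-free with an odd number (one) of prime factors, so the definite quaternion algebra of
discriminant `r` with an Eichler order of level `M` exists (`nonempty_eichlerPackage_holds`,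
Vignéras III §3 Thm. 3.1, II §2, III §5; no square-freeness of `M`). [cite: VignerasLNM800, Ch. III §3 Thm. 3.1 and §5 Prop. 5.1] -/
theorem takahashi2001_thm_2_3_of_coprime.nonempty_xiSetup {M r : ℕ} (hr : r.Prime) (hM : 0 < M)
    (hcop : M.Coprime r) : Nonempty (Brandt.XiSetup M r) := by
  have hodd : Odd r.primeFactors.card := by
    rw [Nat.Prime.primeFactors hr, Finset.card_singleton]; exact odd_one
  exact Brandt.nonempty_xiSetup_of_nonempty_eichlerPackage nonempty_eichlerPackage_holds hM
    hr.squarefree hodd hcop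

/-- The same with the positivity of `M` read off from `M r ≠ 0` (the instance argument
`NeZero (M * r)` of the named fact). [cite: VignerasLNM800, Ch. III §3 Thm. 3.1 and §5 Prop. 5.1] -/
theorem takahashi2001_thm_2_3_of_coprime.nonempty_xiSetup' {M r : ℕ} [NeZero (M * r)]
    (hr : r.Prime) (hcop : M.Coprime r) : Nonempty (Brandt.XiSetup M r) :=
  takahashi2001_thm_2_3_of_coprime.nonempty_xiSetup hr
    (Nat.pos_of_ne_zero fun h => NeZero.ne (M * r) (by rw [h, zero_mul])) hcop

/-! ### The fact from its conclusion, or from the §2 dictionary, in ONE setup -/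

/-- **`takahashi2001_thm_2_3_of_coprime` from its conclusion in one setup per optimal curve**: if
for every `(W, M, r, P)` as in the fact (granted that a setup of type `(M, r)` exists) SOME Brandt
setup `S₀` satisfies `∃ i j, 0 < i ∧ i j = ord_r Δ_min ∧ i ∣ ξ_{S₀} ∧ δ i = ξ_{S₀} j`, then every
setup does, because `ξ_S = ξ_{S₀}` (`Brandt.XiSetup.xi_eq_xi`). This is how the identification of
p. 84 — which concerns the ONE Eichler order cut out by the supersingular points — feeds the
fact's quantifier over all setups. [cite: Takahashi2001, Thm. 2.3 with proof of Thm. 3.8 (p. 84)] [cite: VignerasLNM800, Ch. III §5] -/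
theorem takahashi2001_thm_2_3_of_coprime_of_exists_setup
    (h : ∀ (W : WeierstrassCurve ℚ) [W.IsElliptic] (M r : ℕ) [NeZero (M * r)],
      r.Prime → M.Coprime r → W.conductorNorm ℤ = M * r →
      ∀ P : ModularParametrizationData W (M * r),
        (∀ (W' : WeierstrassCurve ℚ) [W'.IsElliptic], W'.conductorNorm ℤ = M * r →
            ∀ P' : ModularParametrizationData W' (M * r),
            P'.f = P.f → P.modularDegree ≤ P'.modularDegree) →
        Nonempty (Brandt.XiSetup M r) →
        ∃ (S₀ : Brandt.XiSetup M r) (i j : ℕ), 0 < i ∧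
          i * j = (W.minimalDiscriminantNorm ℤ).factorization r ∧
          i ∣ S₀.xi (fun n => W.LFunction n) ∧
          P.modularDegree * i = S₀.xi (fun n => W.LFunction n) * j) :
    takahashi2001_thm_2_3_of_coprime := by
  intro W _ M r _ hr hcop hN P hmin S
  obtain ⟨S₀, i, j, hi, hij, hdvd, hδ⟩ := h W M r hr hcop hN P hmin ⟨S⟩
  rw [Brandt.XiSetup.xi_eq_xi S₀ S] at hdvd hδ
  exact ⟨i, j, hi, hij, hdvd, hδ⟩

/-- **`takahashi2001_thm_2_3_of_coprime` from the character-group dictionary of §2 in ONE Brandt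
setup** (Takahashi 2001 §2 with the identification of p. 84, at a prime `r ∥ N`). The hypothesis
`H` is the geometric input written in the coordinates of a setup `S₀ = (D, O)` of type `(M, r)`:
for the optimal curve `W` (datum `P` of minimal degree among the data, at level `M r`, of the
curves of conductor `M r` with the same newform) there are a sublattice `X ⊆ ℤ^{Cls O}` (the
character group `X_r(J₀(Mr))` under Ribet's isometry, Grothendieck's `u_J` becoming Gross's
`Σ_i w_i x_i y_i` [cite: Ribet1990, §3]), maps `pb = π^* : ℤ x_r → X`, `pf = π_* : X → ℤ x_r`
adjoint for `u_J` and `u_E(a, b) = c_r a b` with `c_r = ord_r Δ_min(W)` (Tate curve), with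
`π_* π^* = δ = P.modularDegree`, `π_*` onto (optimality), and `π^* 1 = j g` for a generator `g` of
the `a(W)`-eigen-line of the Brandt matrices ("`L_r(J)` is free of rank one", p. 78). Given `H`
the fact is `Takahashi2001.exists_ij_of_brandtData` (which uses neither square-freeness nor
semistability away from `r`) and `takahashi2001_thm_2_3_of_coprime_of_exists_setup`. PROVED; `H`
(Néron models, SGA7 IX 11.5, Deligne–Rapoport/Ribet, multiplicity one, analytic = algebraic
degree) is not in the tree. [cite: Takahashi2001, Thm. 2.3 (p. 79), remark p. 80, proof of Thm. 3.8 (p. 84)] [cite: PastenShimura2024, Prop. 6.13] -/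
theorem takahashi2001_thm_2_3_of_coprime_of_brandtDictionary_one
    (H : ∀ (W : WeierstrassCurve ℚ) [W.IsElliptic] (M r : ℕ) [NeZero (M * r)],
      r.Prime → M.Coprime r → W.conductorNorm ℤ = M * r →
      ∀ P : ModularParametrizationData W (M * r),
        (∀ (W' : WeierstrassCurve ℚ) [W'.IsElliptic], W'.conductorNorm ℤ = M * r →
            ∀ P' : ModularParametrizationData W' (M * r),
            P'.f = P.f → P.modularDegree ≤ P'.modularDegree) →
        Nonempty (Brandt.XiSetup M r) →
        ∃ (S₀ : Brandt.XiSetup M r) (_ : Fintype (Brandt.ClassSet S₀.O))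
          (X : Submodule ℤ (Brandt.ClassSet S₀.O → ℤ)) (pb : ℤ →ₗ[ℤ] X) (pf : X →ₗ[ℤ] ℤ)
          (g : X) (j : ℤ),
          (∀ (a : ℤ) (y : X),
              ∑ i, (Brandt.weight S₀.O i : ℤ) * (pb a : Brandt.ClassSet S₀.O → ℤ) i *
                  (y : Brandt.ClassSet S₀.O → ℤ) i =
                ((W.minimalDiscriminantNorm ℤ).factorization r : ℤ) * a * pf y) ∧
          (∀ a : ℤ, pf (pb a) = (P.modularDegree : ℤ) * a) ∧
          Function.Surjective pf ∧
          pb 1 = j • g ∧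
          Brandt.eigenLattice (M * r) (Brandt.matrix S₀.O) (fun n => W.LFunction n) =
            ℤ ∙ (g : Brandt.ClassSet S₀.O → ℤ)) :
    takahashi2001_thm_2_3_of_coprime := by
  refine takahashi2001_thm_2_3_of_coprime_of_exists_setup
    fun W _ M r _ hr hcop hN P hmin hne => ?_
  obtain ⟨S₀, _, X, pb, pf, g, j, hadj, hδ, hsurj, hg, hL⟩ := H W M r hr hcop hN P hmin hne
  exact ⟨S₀, Takahashi2001.exists_ij_of_brandtData W M r hr hN P S₀ X pb pf g j hadj hδ hsurj hg hL⟩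

/-- **Rank form of the dictionary**: as `takahashi2001_thm_2_3_of_coprime_of_brandtDictionary_one`,
with the explicit generator replaced by "the `a(W)`-eigen-lattice of the Brandt matrices has rank
one and contains `π^* 1`" together with saturation of `X` in `ℤ^{Cls O}` — the shape in which
(M4) (`X = ℤ[Cls O]⁰`, saturated) and (M5) ("`L_r(J)` is a free `ℤ`-module of rank one", p. 78;
Jacquet–Langlands and strong multiplicity one for the newform of level `M r` inside the `r`-new
part) are printed. PROVED from `Takahashi2001.exists_ij_of_brandtData'`. [cite: Takahashi2001, Thm. 2.3 and §2 p. 78, proof of Thm. 3.8 (p. 84)] -/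
theorem takahashi2001_thm_2_3_of_coprime_of_brandtDictionary_one'
    (H : ∀ (W : WeierstrassCurve ℚ) [W.IsElliptic] (M r : ℕ) [NeZero (M * r)],
      r.Prime → M.Coprime r → W.conductorNorm ℤ = M * r →
      ∀ P : ModularParametrizationData W (M * r),
        (∀ (W' : WeierstrassCurve ℚ) [W'.IsElliptic], W'.conductorNorm ℤ = M * r →
            ∀ P' : ModularParametrizationData W' (M * r),
            P'.f = P.f → P.modularDegree ≤ P'.modularDegree) →
        Nonempty (Brandt.XiSetup M r) →
        ∃ (S₀ : Brandt.XiSetup M r) (_ : Fintype (Brandt.ClassSet S₀.O))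
          (X : Submodule ℤ (Brandt.ClassSet S₀.O → ℤ)) (pb : ℤ →ₗ[ℤ] X) (pf : X →ₗ[ℤ] ℤ),
          (∀ (a : ℤ) (y : X),
              ∑ i, (Brandt.weight S₀.O i : ℤ) * (pb a : Brandt.ClassSet S₀.O → ℤ) i *
                  (y : Brandt.ClassSet S₀.O → ℤ) i =
                ((W.minimalDiscriminantNorm ℤ).factorization r : ℤ) * a * pf y) ∧
          (∀ a : ℤ, pf (pb a) = (P.modularDegree : ℤ) * a) ∧
          Function.Surjective pf ∧
          (∀ (m : ℤ) (v : Brandt.ClassSet S₀.O → ℤ), m ≠ 0 → m • v ∈ X → v ∈ X) ∧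
          Module.finrank ℤ
              (Brandt.eigenLattice (M * r) (Brandt.matrix S₀.O) (fun n => W.LFunction n)) = 1 ∧
          (pb 1 : Brandt.ClassSet S₀.O → ℤ) ∈
            Brandt.eigenLattice (M * r) (Brandt.matrix S₀.O) (fun n => W.LFunction n)) :
    takahashi2001_thm_2_3_of_coprime := by
  refine takahashi2001_thm_2_3_of_coprime_of_exists_setup
    fun W _ M r _ hr hcop hN P hmin hne => ?_
  obtain ⟨S₀, _, X, pb, pf, hadj, hδ, hsurj, hXsat, hrank, hmem⟩ := H W M r hr hcop hN P hmin hne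
  exact ⟨S₀, Takahashi2001.exists_ij_of_brandtData' W M r hr hN P S₀ X pb pf hadj hδ hsurj hXsat
    hrank hmem⟩

/-! ### Corollaries of the named fact at `r ∥ N` -/

namespace takahashi2001_thm_2_3_of_coprime

/-- **`ξ_S · c_r = δ · i_r²`** in every Brandt setup `S` of type `(M, r)`: the displayed identity
`δ · c_r = j_r² · h_r` of the proof of Thm. 2.3 (p. 80) combined with `c_r = i_r j_r`,
`δ i_r = h_r j_r` — here `i ∣ c_r = ord_r Δ_min(W)`, `0 < i`. PROVED from the named fact.
[cite: Takahashi2001, Thm. 2.3 (proof, p. 80)] -/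
theorem xi_mul_eq_modularDegree_mul_sq (h : takahashi2001_thm_2_3_of_coprime) (W : WeierstrassCurve ℚ)
    [W.IsElliptic] (M r : ℕ) [NeZero (M * r)] (hr : r.Prime) (hcop : M.Coprime r)
    (hN : W.conductorNorm ℤ = M * r) (P : ModularParametrizationData W (M * r))
    (hmin : ∀ (W' : WeierstrassCurve ℚ) [W'.IsElliptic], W'.conductorNorm ℤ = M * r →
      ∀ P' : ModularParametrizationData W' (M * r),
        P'.f = P.f → P.modularDegree ≤ P'.modularDegree) (S : Brandt.XiSetup M r) :
    ∃ i : ℕ, 0 < i ∧ i ∣ (W.minimalDiscriminantNorm ℤ).factorization r ∧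
      S.xi (fun n => W.LFunction n) * (W.minimalDiscriminantNorm ℤ).factorization r =
        P.modularDegree * i ^ 2 := by
  obtain ⟨i, j, hi, hij, -, hδ⟩ := h W M r hr hcop hN P hmin S
  refine ⟨i, hi, ⟨j, hij.symm⟩, ?_⟩
  have key : S.xi (fun n => W.LFunction n) * (i * j) = P.modularDegree * i ^ 2 :=
    calc S.xi (fun n => W.LFunction n) * (i * j) = S.xi (fun n => W.LFunction n) * j * i := by
          ring
      _ = P.modularDegree * i * i := by rw [← hδ]
      _ = P.modularDegree * i ^ 2 := by ring
  rwa [hij] at key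

/-- **`δ ∣ ξ_S · ord_r Δ_min(E)`** in every setup (from `ξ_S c_r = δ i_r²`). PROVED from the named
fact. [cite: Takahashi2001, Thm. 2.3] -/
theorem modularDegree_dvd_xi_mul (h : takahashi2001_thm_2_3_of_coprime) (W : WeierstrassCurve ℚ)
    [W.IsElliptic] (M r : ℕ) [NeZero (M * r)] (hr : r.Prime) (hcop : M.Coprime r)
    (hN : W.conductorNorm ℤ = M * r) (P : ModularParametrizationData W (M * r))
    (hmin : ∀ (W' : WeierstrassCurve ℚ) [W'.IsElliptic], W'.conductorNorm ℤ = M * r →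
      ∀ P' : ModularParametrizationData W' (M * r),
        P'.f = P.f → P.modularDegree ≤ P'.modularDegree) (S : Brandt.XiSetup M r) :
    P.modularDegree ∣
      S.xi (fun n => W.LFunction n) * (W.minimalDiscriminantNorm ℤ).factorization r := by
  obtain ⟨i, -, -, hsq⟩ := xi_mul_eq_modularDegree_mul_sq h W M r hr hcop hN P hmin S
  exact ⟨i ^ 2, hsq⟩

/-- **"In particular, `j_r` divides `δ`"** (Thm. 2.3, p. 79): with `i = i_r`, `j = j_r`,
`i j = c_r = ord_r Δ_min(W)`, the cokernel order `j` divides the optimal modular degree, since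
`δ = (h_r / i_r) · j_r` with `i_r ∣ h_r = ξ_S`. PROVED from the named fact. [cite: Takahashi2001, Thm. 2.3 (p. 79)] -/
theorem exists_coker_dvd_modularDegree (h : takahashi2001_thm_2_3_of_coprime) (W : WeierstrassCurve ℚ)
    [W.IsElliptic] (M r : ℕ) [NeZero (M * r)] (hr : r.Prime) (hcop : M.Coprime r)
    (hN : W.conductorNorm ℤ = M * r) (P : ModularParametrizationData W (M * r))
    (hmin : ∀ (W' : WeierstrassCurve ℚ) [W'.IsElliptic], W'.conductorNorm ℤ = M * r →
      ∀ P' : ModularParametrizationData W' (M * r),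
        P'.f = P.f → P.modularDegree ≤ P'.modularDegree) (S : Brandt.XiSetup M r) :
    ∃ i j : ℕ, 0 < i ∧ i * j = (W.minimalDiscriminantNorm ℤ).factorization r ∧
      i ∣ S.xi (fun n => W.LFunction n) ∧ j ∣ P.modularDegree ∧
      P.modularDegree * i = S.xi (fun n => W.LFunction n) * j := by
  obtain ⟨i, j, hi, hij, hdvd, hδ⟩ := h W M r hr hcop hN P hmin S
  obtain ⟨k, hk⟩ := hdvd
  refine ⟨i, j, hi, hij, ⟨k, hk⟩, ⟨k, ?_⟩, hδ⟩
  have h1 : P.modularDegree * i = j * k * i := by rw [hδ, hk]; ring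
  exact Nat.eq_of_mul_eq_mul_right hi h1

/-- **`δ_1(N) ≤ ξ_S(E; M, r) · ord_r Δ_min(E)`** in every Brandt setup `S` of type `(M, r)`, for
the optimal curve `E` of conductor `N = M r`, `r ∥ N` (from `δ i = ξ j`, `i ≥ 1`, `i j = c_r`; no
Eisenstein hypothesis, no square-freeness of `M`). PROVED from the named fact. [cite: Takahashi2001, Thm. 2.3] -/
theorem modularDegree_le_xi_mul (h : takahashi2001_thm_2_3_of_coprime) (W : WeierstrassCurve ℚ)
    [W.IsElliptic] (M r : ℕ) [NeZero (M * r)] (hr : r.Prime) (hcop : M.Coprime r)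
    (hN : W.conductorNorm ℤ = M * r) (P : ModularParametrizationData W (M * r))
    (hmin : ∀ (W' : WeierstrassCurve ℚ) [W'.IsElliptic], W'.conductorNorm ℤ = M * r →
      ∀ P' : ModularParametrizationData W' (M * r),
        P'.f = P.f → P.modularDegree ≤ P'.modularDegree) (S : Brandt.XiSetup M r) :
    P.modularDegree ≤
      S.xi (fun n => W.LFunction n) * (W.minimalDiscriminantNorm ℤ).factorization r := by
  obtain ⟨i, j, hi, hij, -, hδ⟩ := h W M r hr hcop hN P hmin S
  calc P.modularDegree ≤ P.modularDegree * i := Nat.le_mul_of_pos_right _ hi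
    _ = S.xi (fun n => W.LFunction n) * j := hδ
    _ ≤ S.xi (fun n => W.LFunction n) * (i * j) :=
        Nat.mul_le_mul_left _ (Nat.le_mul_of_pos_left _ hi)
    _ = _ := by rw [hij]

/-- **`δ_1(N) ≤ ξ(E; M, r) · ord_r Δ_min(E)`** with `ξ = brandtXi M r (a(E))` (the value on the
chosen setup), unconditionally in the existence of setups (they exist:
`takahashi2001_thm_2_3_of_coprime.nonempty_xiSetup'`). PROVED from the named fact. [cite: Takahashi2001, Thm. 2.3] -/
theorem modularDegree_le_brandtXi_mul (h : takahashi2001_thm_2_3_of_coprime) (W : WeierstrassCurve ℚ)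
    [W.IsElliptic] (M r : ℕ) [NeZero (M * r)] (hr : r.Prime) (hcop : M.Coprime r)
    (hN : W.conductorNorm ℤ = M * r) (P : ModularParametrizationData W (M * r))
    (hmin : ∀ (W' : WeierstrassCurve ℚ) [W'.IsElliptic], W'.conductorNorm ℤ = M * r →
      ∀ P' : ModularParametrizationData W' (M * r),
        P'.f = P.f → P.modularDegree ≤ P'.modularDegree) :
    P.modularDegree ≤
      brandtXi M r (fun n => W.LFunction n) * (W.minimalDiscriminantNorm ℤ).factorization r := by
  obtain ⟨S, hS⟩ := exists_brandtXi_eq (nonempty_xiSetup' hr hcop) (fun n => W.LFunction n)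
  rw [hS]
  exact modularDegree_le_xi_mul h W M r hr hcop hN P hmin S

/-- **The eigen-line is honest: `ξ_S ≥ 1`** in every setup of type `(M, r)` in the situation of
the fact (so the `a(E)`-eigen-lattice of the Brandt matrices is a line and `S.xi = Σ_i w_i g_i²`
is not the junk value `0`; Takahashi p. 78: "`L_r(J)` is a free `ℤ`-module of rank one"), because
`δ ≥ 1` and `i ≥ 1`. PROVED from the named fact. [cite: Takahashi2001, §2 p. 78 and Thm. 2.3] -/
theorem xi_pos (h : takahashi2001_thm_2_3_of_coprime) (W : WeierstrassCurve ℚ)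
    [W.IsElliptic] (M r : ℕ) [NeZero (M * r)] (hr : r.Prime) (hcop : M.Coprime r)
    (hN : W.conductorNorm ℤ = M * r) (P : ModularParametrizationData W (M * r))
    (hmin : ∀ (W' : WeierstrassCurve ℚ) [W'.IsElliptic], W'.conductorNorm ℤ = M * r →
      ∀ P' : ModularParametrizationData W' (M * r),
        P'.f = P.f → P.modularDegree ≤ P'.modularDegree) (S : Brandt.XiSetup M r) : 0 < S.xi (fun n => W.LFunction n) := by
  obtain ⟨i, j, hi, -, -, hδ⟩ := h W M r hr hcop hN P hmin S
  refine Nat.pos_of_ne_zero fun h0 => ?_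
  rw [h0, zero_mul] at hδ
  exact (Nat.mul_pos P.deg_pos hi).ne' hδ

/-- `ξ(E; M, r) = brandtXi M r (a(E)) ≥ 1` in the situation of the fact. PROVED from the named
fact. [cite: Takahashi2001, §2 p. 78 and Thm. 2.3] -/
theorem brandtXi_pos (h : takahashi2001_thm_2_3_of_coprime) (W : WeierstrassCurve ℚ)
    [W.IsElliptic] (M r : ℕ) [NeZero (M * r)] (hr : r.Prime) (hcop : M.Coprime r)
    (hN : W.conductorNorm ℤ = M * r) (P : ModularParametrizationData W (M * r))
    (hmin : ∀ (W' : WeierstrassCurve ℚ) [W'.IsElliptic], W'.conductorNorm ℤ = M * r →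
      ∀ P' : ModularParametrizationData W' (M * r),
        P'.f = P.f → P.modularDegree ≤ P'.modularDegree) : 0 < brandtXi M r (fun n => W.LFunction n) := by
  obtain ⟨S, hS⟩ := exists_brandtXi_eq (nonempty_xiSetup' hr hcop) (fun n => W.LFunction n)
  rw [hS]
  exact xi_pos h W M r hr hcop hN P hmin S

end takahashi2001_thm_2_3_of_coprime

end Literature.NumberTheory.EllipticCurves
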